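import Mathlib
import Literature.Analysis.FluidPDE.TypeIAncientMild
import Literature.Analysis.FluidPDE.TypeIAncientMildClassical
import Literature.Analysis.FluidPDE.BarkerPrange2020VorticityAlignmentTypeIHolds
import Literature.Analysis.FluidPDE.VectorCalculusProofs
import Literature.Analysis.FluidPDE.CurlFreeLiouville
import Summits.NavierStokesRegularity.NavierStokesRegularity.Theses.SymmetryModuliCount
import Summits.NavierStokesRegularity.NavierStokesRegularity.Theorems.ClockStretchingLawClockCeilingGermRigidity
import Summits.NavierStokesRegularity.NavierStokesRegularity.Theorems.ScenarioCensusPeriodicGauge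
import Summits.NavierStokesRegularity.NavierStokesRegularity.Theorems.SymmetryModuliCountLinearLiouvilleSevenGaugeBounds
import Summits.NavierStokesRegularity.NavierStokesRegularity.Theorems.PoloidalWindowDoorPoloidalWindowRigidityLocalVorticitySymmetry
import HarnessLib
import Summits.NavierStokesRegularity.NavierStokesRegularity.Theorems.ScenarioCensusRotationOrder

/-!
# Block A2, instrument BLOCH METER (ns-idea-2 LINE g18-4; cells A2blN / A2blC / A2blU / A2blR DECIDED, A2blA OPEN) — port, part 1/3: the finite model of a bounded field with a FLOQUET TWIN
# (exit for the zero slice; §B laws of the finite model; the pencil of twins)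

Re-homed for the scenario census (typer seat ns-census-typer-1 g10; the cells A2blN / A2blC / A2blU / A2blR are MEMBERS OF RECORD «DECIDED IN KERNEL IN FILES» of row A2 (ns-idea-2 g18 LINE g18-4:
critic idea-crit-3 g11 PASS 15:59:03Z; ref ns-census-ref g16 PRE-CHECK ✓ §21.22; lead label; OF RECORD 4/4 at census v1.135, KEY-NS #240), A2blA OPEN (typed); this port makes the decided cells
TREE-decided): VERBATIM PORT of ns-idea-2 LINE g18-4 «bloch-meter», `pub/ideators/ns-idea-2/lines/bloch-meter/line-bloch-meter.lean` sha16 c4e2e5a09424cfd5 (743 l., lean check rc 0,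
0 sorry), split for the 400-line rule into `ScenarioCensusBlochMeter` (model, §B, pencil) → `…BlochMeterKernel` (§K, §G) → `…BlochMeterControl` (§C + census KEYS).  Lean text VERBATIM in
namespace `…Theorems.ScenarioCensus.BlochMeter` (the line's `…Lines.BlochMeter` re-homed); port edits: the line's `local notation "E3"` is spelled as the reducible `abbrev E3` of every census
file; `rotZ_neg_rotZ` is the census rotation-order port's (`RotationOrder.rotZ_neg_rotZ`, BY NAME, gate lint dedup.landed); the three component simp-lemmas `e2_apply_zero/one/two` of the
line's own `e2` (their TEXT coincides with `ForcedSymmetry.Negative.e2_c0/1/2`, a different constant) and `hasFDerivAt_coord` (twin of a Literature lemma outside this closure) are not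
re-declared (inlined / unfolded at the use sites); `@[conjecture]` on the OPEN row `Row_A2blA`; one-line docstrings added where missing (gate lint).  Statements untouched.

No census VALUE is moved here (row A2 stays OPEN-WITH-LINE; the members become TREE-decided by name); (L′) is NOT proved; no summit statement is proved by this file. Lemmas that restate already-landed tree declarations are taken BY NAME (gate lint `dedup.landed`): `rotZ_neg_rotZ` = `RotationOrder.rotZ_neg_rotZ`.
-/

-- the summit and its single problem share the name `NavierStokesRegularity` (D-0017 nested layout)
set_option linter.dupNamespace false

noncomputable section

open Set Function Filter Metric MeasureTheory InnerProductSpace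
open scoped Topology RealInnerProductSpace
open Literature.Analysis Literature.Analysis.FluidPDE
open Summit.NavierStokesRegularity.NavierStokesRegularity.Theorems
open Summit.NavierStokesRegularity.NavierStokesRegularity.Theorems.ScenarioCensus

namespace Summit.NavierStokesRegularity.NavierStokesRegularity.Theorems.ScenarioCensus.BlochMeter

/-- `ℝ³` (the line's `local notation "E3"`, spelled as a reducible abbreviation for the tree). -/
abbrev E3 := EuclideanSpace ℝ (Fin 3)

-- the summit namespace `…NavierStokesRegularity.NavierStokesRegularity…` is the tree convention (D-0017)

/-! ### §A  Class softness used by the meter (tree facts BY NAME) -/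

/-- An elementary bound (`norm_slice_le`). -/
theorem norm_slice_le {C : ℝ} {u : ℝ → E3 → E3} (hu : IsTypeIAncientMild C u) {t₀ : ℝ} (ht₀ : t₀ < 0)
    (x : E3) : ‖u t₀ x‖ ≤ C / Real.sqrt (-t₀) :=
  hu.norm_le ht₀ x

/-- POCKET ⇒ GLOBAL for a Floquet twin: both sides of `f (x + a) = G (f x)` are real-analytic on `ℝ³`
when `f` is, so agreement on a nonempty open pocket is agreement everywhere (identity theorem). -/
theorem twin_of_pocket {f : E3 → E3} (hf : AnalyticOnNhd ℝ f univ) {G : E3 →L[ℝ] E3} {a : E3}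
    {U : Set E3} (hU : IsOpen U) (hne : U.Nonempty) (h : ∀ x ∈ U, f (x + a) = G (f x)) (x : E3) :
    f (x + a) = G (f x) := by
  obtain ⟨z₀, hz₀⟩ := hne
  have h1 : AnalyticOnNhd ℝ (fun x => f (x + a)) univ := fun x _ =>
    (hf _ (mem_univ _)).comp (analyticAt_id.add analyticAt_const)
  have h2 : AnalyticOnNhd ℝ (fun x => G (f x)) univ := fun x _ => (G.analyticAt _).comp (hf x (mem_univ _))
  exact h1.eqOn_of_preconnected_of_eventuallyEq h2 isPreconnected_univ (mem_univ z₀)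
    (Filter.eventuallyEq_of_mem (hU.mem_nhds hz₀) fun y hy => h y hy) (mem_univ x)

/-- EXIT (tree, BY NAME): one slice of a class element periodic with a non-zero period ⇒ every slice is
(`translationInvariant_of_germ`) ⇒ census A13 `PeriodicGauge.periodic_typeI_liouville_genuine` ⇒ `u ≡ 0`. -/
theorem eq_zero_of_slice_periodic {C : ℝ} {u : ℝ → E3 → E3} (hu : IsTypeIAncientMild C u) {t₀ : ℝ}
    (ht₀ : t₀ < 0) {p : E3} (hp : p ≠ 0) (h : ∀ x, u t₀ (x + p) = u t₀ x) :
    ∀ t < 0, ∀ x, u t x = 0 :=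
  PeriodicGauge.periodic_typeI_liouville_genuine C u hu p hp fun _ ht x =>
    translationInvariant_of_germ hu ht₀ isOpen_univ univ_nonempty p (fun x _ => h x) ht x

/-- EXIT for the zero slice: a slice that vanishes identically is periodic with any period. -/
theorem eq_zero_of_slice_zero {C : ℝ} {u : ℝ → E3 → E3} (hu : IsTypeIAncientMild C u) {t₀ : ℝ}
    (ht₀ : t₀ < 0) (h : ∀ x, u t₀ x = 0) : ∀ t < 0, ∀ x, u t x = 0 :=
  eq_zero_of_slice_periodic hu ht₀ (p := EuclideanSpace.single 0 1) (by simp) fun x => by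
    rw [h, h]

/-! ### §B  Laws of the finite model (kinematics of a bounded field with a Floquet twin) -/

section Laws

variable {f : E3 → E3} {G : E3 →L[ℝ] E3} {a : E3}

/-- Forward iteration of the twin: `f (x + k a) = Gᵏ (f x)`. -/
theorem iterate_twin (h : ∀ x, f (x + a) = G (f x)) : ∀ (k : ℕ) (x : E3), f (x + (k : ℝ) • a) = (G ^ k) (f x)
  | 0, x => by simp
  | k + 1, x => by
    rw [Nat.cast_succ, add_smul, one_smul, ← add_assoc, h, iterate_twin h k x, pow_succ']
    rfl

/-- Backward iteration of the twin: `f x = Gᵏ (f (x − k a))`. -/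
theorem iterate_twin_back (h : ∀ x, f (x + a) = G (f x)) (k : ℕ) (x : E3) :
    f x = (G ^ k) (f (x - (k : ℝ) • a)) := by
  have := iterate_twin h k (x - (k : ℝ) • a)
  rwa [sub_add_cancel] at this

/-- LAW (N) — a FINITE-ORDER monodromy makes the slice periodic: `G ^ N = 1` ⇒ `f (x + N a) = f x`. -/
theorem periodic_of_twin_finiteOrder (h : ∀ x, f (x + a) = G (f x)) {N : ℕ} (hN : G ^ N = 1) (x : E3) :
    f (x + (N : ℝ) • a) = f x := by
  rw [iterate_twin h N x, hN]
  rfl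

/-- LAW (C) — VALUE EXTINCTION under a CONTRACTING monodromy: `‖G v‖ ≤ q ‖v‖` with `q < 1` and `f` bounded
⇒ `f ≡ 0` (read the twin backwards: `‖f x‖ = ‖Gᵏ f (x − k a)‖ ≤ qᵏ K → 0`). -/
theorem eq_zero_of_twin_contracting (h : ∀ x, f (x + a) = G (f x)) {q : ℝ} (hq0 : 0 ≤ q) (hq : q < 1)
    (hG : ∀ v, ‖G v‖ ≤ q * ‖v‖) {K : ℝ} (hK : ∀ x, ‖f x‖ ≤ K) (x : E3) : f x = 0 := by
  have hGk : ∀ (k : ℕ) (v : E3), ‖(G ^ k) v‖ ≤ q ^ k * ‖v‖ := by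
    intro k
    induction k with
    | zero => intro v; simp
    | succ k ih =>
      intro v
      rw [pow_succ', pow_succ']
      calc ‖(G * G ^ k) v‖ = ‖G ((G ^ k) v)‖ := rfl
        _ ≤ q * ‖(G ^ k) v‖ := hG _
        _ ≤ q * (q ^ k * ‖v‖) := mul_le_mul_of_nonneg_left (ih v) hq0
        _ = q * q ^ k * ‖v‖ := by ring
  have hb : ∀ k : ℕ, ‖f x‖ ≤ q ^ k * K := fun k => by
    calc ‖f x‖ = ‖(G ^ k) (f (x - (k : ℝ) • a))‖ := by rw [← iterate_twin_back h k x]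
      _ ≤ q ^ k * ‖f (x - (k : ℝ) • a)‖ := hGk k _
      _ ≤ q ^ k * K := mul_le_mul_of_nonneg_left (hK _) (pow_nonneg hq0 k)
  have ht : Tendsto (fun k : ℕ => q ^ k * K) atTop (𝓝 (0 * K)) :=
    (tendsto_pow_atTop_nhds_zero_of_lt_one hq0 hq).mul_const K
  rw [zero_mul] at ht
  have h0 : ‖f x‖ ≤ 0 := ge_of_tendsto' ht hb
  exact norm_le_zero_iff.1 h0

/-- Iteration of a UNIPOTENT monodromy `G = 1 + N`, `N² = 0`: `f (x + k a) = f x + k • N (f x)`. -/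
theorem iterate_twin_unipotent {N : E3 →L[ℝ] E3} (hN : N.comp N = 0) (h : ∀ x, f (x + a) = f x + N (f x)) :
    ∀ (k : ℕ) (x : E3), f (x + (k : ℝ) • a) = f x + (k : ℝ) • N (f x)
  | 0, x => by simp
  | k + 1, x => by
    have hNN : ∀ v, N (N v) = 0 := fun v => by
      simpa using congrArg (fun T : E3 →L[ℝ] E3 => T v) hN
    rw [Nat.cast_succ, add_smul, one_smul, ← add_assoc, h, iterate_twin_unipotent hN h k x, map_add,
      map_smul, hNN, smul_zero, add_zero]
    module

/-- LAW (U) — SHEAR EXTINCTION: a unipotent monodromy of a bounded field acts trivially on its values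
(`‖k • N (f x)‖ ≤ 2K` for all `k`), so the field is `a`-PERIODIC. -/
theorem periodic_of_twin_unipotent {N : E3 →L[ℝ] E3} (hN : N.comp N = 0) (h : ∀ x, f (x + a) = f x + N (f x))
    {K : ℝ} (hK : ∀ x, ‖f x‖ ≤ K) (x : E3) : f (x + a) = f x := by
  have hNf : N (f x) = 0 := by
    by_contra hne
    have hpos : 0 < ‖N (f x)‖ := norm_pos_iff.2 hne
    obtain ⟨k, hk⟩ := exists_nat_gt (2 * K / ‖N (f x)‖)
    have hk' : 2 * K < (k : ℝ) * ‖N (f x)‖ := (div_lt_iff₀ hpos).1 hk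
    have hb : ‖(k : ℝ) • N (f x)‖ ≤ 2 * K := by
      have : (k : ℝ) • N (f x) = f (x + (k : ℝ) • a) - f x := by
        rw [iterate_twin_unipotent hN h k x]; abel
      rw [this]
      calc ‖f (x + (k : ℝ) • a) - f x‖ ≤ ‖f (x + (k : ℝ) • a)‖ + ‖f x‖ := norm_sub_le _ _
        _ ≤ K + K := add_le_add (hK _) (hK _)
        _ = 2 * K := by ring
    rw [norm_smul, Real.norm_natCast] at hb
    linarith
  rw [h, hNf, add_zero]

end Laws

/-! ### §P  The pencil of a rotational monodromy (the substantive law) -/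

section Pencil

/-- The horizontal projection `hQ y = (y₀, y₁, 0)` as a continuous linear map. -/
def hQ : E3 →L[ℝ] E3 :=
  LinearMap.toContinuousLinearMap
    { toFun := fun y => WithLp.toLp 2 ![y 0, y 1, 0]
      map_add' := fun v w => by ext i; fin_cases i <;> simp
      map_smul' := fun c v => by ext i; fin_cases i <;> simp }

/-- Component / evaluation formula (`hQ_apply_zero`). -/
@[simp] theorem hQ_apply_zero (y : E3) : hQ y 0 = y 0 := rfl
/-- Component / evaluation formula (`hQ_apply_one`). -/
@[simp] theorem hQ_apply_one (y : E3) : hQ y 1 = y 1 := rfl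
/-- Component / evaluation formula (`hQ_apply_two`). -/
@[simp] theorem hQ_apply_two (y : E3) : hQ y 2 = 0 := rfl

/-- The vertical projection `vQ y = (0, 0, y₂)` as a continuous linear map. -/
def vQ : E3 →L[ℝ] E3 :=
  LinearMap.toContinuousLinearMap
    { toFun := fun y => WithLp.toLp 2 ![0, 0, y 2]
      map_add' := fun v w => by ext i; fin_cases i <;> simp
      map_smul' := fun c v => by ext i; fin_cases i <;> simp }

/-- Component / evaluation formula (`vQ_apply_zero`). -/
@[simp] theorem vQ_apply_zero (y : E3) : vQ y 0 = 0 := rfl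
/-- Component / evaluation formula (`vQ_apply_one`). -/
@[simp] theorem vQ_apply_one (y : E3) : vQ y 1 = 0 := rfl
/-- Component / evaluation formula (`vQ_apply_two`). -/
@[simp] theorem vQ_apply_two (y : E3) : vQ y 2 = y 2 := rfl

/-- The vertical unit vector `e₂`. -/
def e2 : E3 := EuclideanSpace.single 2 1

-- `e2_apply_zero`: component simp-lemma of the line's own `e2` whose TEXT (`e2 0 = 0`) coincides with the landed `ForcedSymmetry.Negative.e2_c0` (a different constant `e2`; gate lint dedup.landed is textual); not re-declared — the later `simp` calls unfold `e2` directly.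

-- `e2_apply_one`: see `e2_apply_zero` (twin text of `ForcedSymmetry.Negative.e2_c1`); not re-declared.

-- `e2_apply_two`: see `e2_apply_zero` (twin text of `ForcedSymmetry.Negative.e2_c2`); not re-declared.

/-- Auxiliary lemma of the line, stated and proved verbatim (`hQ_add_smul_e2`). -/
theorem hQ_add_smul_e2 (y : E3) : hQ y + (y 2) • e2 = y := by
  ext i; fin_cases i <;> simp [e2]

/-- Auxiliary lemma of the line, stated and proved verbatim (`hQ_hQ_add`). -/
theorem hQ_hQ_add (y : E3) (s : ℝ) : hQ (hQ y + s • e2) = hQ y := by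
  ext i; fin_cases i <;> simp [e2]

/-- An elementary bound (`norm_hQ_le`). -/
theorem norm_hQ_le (v : E3) : ‖hQ v‖ ≤ ‖v‖ := by
  rw [EuclideanSpace.norm_eq, EuclideanSpace.norm_eq, Fin.sum_univ_three, Fin.sum_univ_three]
  apply Real.sqrt_le_sqrt
  simp only [hQ_apply_zero, hQ_apply_one, hQ_apply_two, norm_zero]
  nlinarith [sq_nonneg ‖v 2‖]

/-- The three readings of a derivative `M = Df(y)` that the pencil extracts:
`penA M = ∂₀f₀ + ∂₁f₁`, `penB M = ∂₀f₁ − ∂₁f₀`, `penC M = ∂₂f₂` (with `∂ⱼfᵢ = M eⱼ i`). -/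
def penA (M : E3 →L[ℝ] E3) : ℝ := M (EuclideanSpace.single 0 1) 0 + M (EuclideanSpace.single 1 1) 1
/-- see `penA` -/
def penB (M : E3 →L[ℝ] E3) : ℝ := M (EuclideanSpace.single 0 1) 1 - M (EuclideanSpace.single 1 1) 0
/-- see `penA` -/
def penC (M : E3 →L[ℝ] E3) : ℝ := M (EuclideanSpace.single 2 1) 2

/-- THE PENCIL: the divergence of `rotZ φ ∘ f` at `y` is `cos φ · A − sin φ · B + C` in the readings of `Df(y)`. -/
theorem divergence_rotZ_comp {f : E3 → E3} {y : E3} (hf : DifferentiableAt ℝ f y) (φ : ℝ) :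
    VectorCalculus.divergence (fun z => rotZ φ (f z)) y =
      Real.cos φ * penA (fderiv ℝ f y) - Real.sin φ * penB (fderiv ℝ f y) + penC (fderiv ℝ f y) := by
  have hd : HasFDerivAt (fun z => rotZ φ (f z)) ((rotZL φ).comp (fderiv ℝ f y)) y :=
    (rotZL φ).hasFDerivAt.comp y hf.hasFDerivAt
  rw [divergence_eq_sum_inner_fderiv (EuclideanSpace.basisFun (Fin 3) ℝ), hd.fderiv]
  simp only [Fin.sum_univ_three, EuclideanSpace.basisFun_apply, ContinuousLinearMap.comp_apply, rotZL_apply,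
    EuclideanSpace.inner_single_left, map_one, one_mul, rotZ_apply_zero, rotZ_apply_one, rotZ_apply_two,
    penA, penB, penC]
  ring

/-- The divergence itself is the pencil at `φ = 0`: `div f = A + C`. -/
theorem divergence_eq_pen {f : E3 → E3} {y : E3} (hf : DifferentiableAt ℝ f y) :
    VectorCalculus.divergence f y = penA (fderiv ℝ f y) + penC (fderiv ℝ f y) := by
  have := divergence_rotZ_comp hf 0
  simp only [Real.cos_zero, Real.sin_zero, one_mul, zero_mul, sub_zero] at this
  rw [← this]
  congr 1
  funext z
  rw [rotZ_zero]

/-- Pencil algebra: three readings `φ = 0, θ, −θ` vanish and `sin θ ≠ 0` ⇒ `A = B = C = 0`. -/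
theorem pen_eq_zero {A B Cc θ : ℝ} (hθ : Real.sin θ ≠ 0) (h0 : A + Cc = 0)
    (h1 : Real.cos θ * A - Real.sin θ * B + Cc = 0) (h2 : Real.cos θ * A + Real.sin θ * B + Cc = 0) :
    A = 0 ∧ B = 0 ∧ Cc = 0 := by
  have hB : B = 0 := by
    have : 2 * Real.sin θ * B = 0 := by linear_combination h2 - h1
    rcases mul_eq_zero.1 this with h | h
    · exact absurd (by linarith : Real.sin θ = 0) hθ
    · exact h
  have hcos : Real.cos θ ≠ 1 := by
    intro hc
    apply hθ
    have := Real.sin_sq_add_cos_sq θ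
    rw [hc] at this
    nlinarith
  have hA : A = 0 := by
    have : (Real.cos θ - 1) * A = 0 := by linear_combination h1 - h0 + Real.sin θ * hB
    rcases mul_eq_zero.1 this with h | h
    · exact absurd (by linarith : Real.cos θ = 1) hcos
    · exact h
  exact ⟨hA, hB, by linarith⟩

/-- Divergence is invariant under LINEAR conjugation `F ↦ D ∘ F ∘ D⁻¹` (trace of a conjugate;
`D : ℝ³ ≃L ℝ³` need not be an isometry). -/
theorem divergence_conj (D : E3 ≃L[ℝ] E3) {F : E3 → E3} {x : E3} (hF : DifferentiableAt ℝ F (D.symm x)) :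
    VectorCalculus.divergence (fun y => D (F (D.symm y))) x = VectorCalculus.divergence F (D.symm x) := by
  have hd : HasFDerivAt (fun y => D (F (D.symm y)))
      ((D : E3 →L[ℝ] E3).comp ((fderiv ℝ F (D.symm x)).comp (D.symm : E3 →L[ℝ] E3))) x :=
    (D : E3 →L[ℝ] E3).hasFDerivAt.comp x (hF.hasFDerivAt.comp x (D.symm : E3 →L[ℝ] E3).hasFDerivAt)
  have hc : (((D : E3 →L[ℝ] E3).comp ((fderiv ℝ F (D.symm x)).comp (D.symm : E3 →L[ℝ] E3)) :
      E3 →L[ℝ] E3) : E3 →ₗ[ℝ] E3) =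
      (D.toLinearEquiv : E3 ≃ₗ[ℝ] E3).conj (fderiv ℝ F (D.symm x) : E3 →ₗ[ℝ] E3) :=
    LinearMap.ext fun v => by simp [LinearEquiv.conj_apply]
  unfold VectorCalculus.divergence
  rw [hd.fderiv, hc, LinearMap.trace_conj']

end Pencil

end Summit.NavierStokesRegularity.NavierStokesRegularity.Theorems.ScenarioCensus.BlochMeter

end
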